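import Literature.Probability.RandomPlanarGeometry.SimpleCurves
import Literature.Probability.RandomPlanarGeometry.SimpleCurveLaws
import HarnessLib

/-!
# Marked first-hit lemma — stub `stub_markedOfShadowing` of the line `marked-point-revisit`
(crux `SAWLoopFugacityFlow.SimpleSubseqLimits`, stmt-CriticalPhenomena-4982)

The second of the two deterministic lemmas of the line: a shadowing configuration of a curve `γ`
against an injective curve `η` (`γ` first reaches the arc point `η y₁` at time `s`; the band
`[y₀, y₁)` of arc levels is visited before `s` and again in `(s, t]`) forces, for an OPEN NONEMPTY
set of parameters `(z, ρ, R)`, a marked first-hit configuration `(lam, T)` of `γ` together with an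
EXACT later revisit of the marked point: `γ t' = γ lam` for some `t' > T`.

Proof. Let `d := infDist (η y₁) (η '' [0, y₀]) > 0` (`η` injective, `y₀ < y₁`, the image compact)
and `U := {(z, ρ, R) | ρ < R, dist z (η y₁) < ρ, R + dist z (η y₁) < d}` (open, contains
`(η y₁, d/4, d/2)`). For `(z, ρ, R) ∈ U` let `T` be the FIRST time `γ` enters `closedBall z ρ`
(`T ≤ s` as `γ s = η y₁`), and `lam` the LAST time `≤ T` at which `dist (γ ·) z ≥ R` (there is
one: `γ 0 = η 0 ∈ η '' [0, y₀]`, so `dist (γ 0) (η y₁) ≥ d > R + dist z (η y₁)` and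
`dist (γ 0) z > R`). Then `lam < T`, `dist (γ u) z < R` on `(lam, T]`, and `dist (γ lam) z = R` by
the intermediate value theorem, so `MarkedConfig γ z ρ R lam T`. Finally `lam < s ≤ t`, so
`γ lam = η y` with `y ≤ y₁` (clause 5 of the shadowing configuration), `y ≠ y₁` (clause 4), and
`y₀ ≤ y` since otherwise `dist (γ lam) (η y₁) ≥ d > R + dist z (η y₁) ≥ dist (γ lam) (η y₁)`;
clause 6 then yields `r' ∈ (s, t]` with `γ r' = η y = γ lam`, and `T ≤ s < r'`.

The predicates `ShadowConfig` and `MarkedConfig` are VERBATIM copies of the shared vocabulary of the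
line (the registered skeleton `Cruxes/SimpleSubseqLimits/Lines/marked-point-revisit.lean`), kept in
the sub-namespace `…MarkedPointRevisit.Marked` so that they can never collide with the skeleton's or
the sibling stub files' copies; they agree with those by `Iff.rfl`.
-/

noncomputable section

open MeasureTheory Filter Topology Set Metric
open Literature.Probability.RandomPlanarGeometry
open scoped ENNReal NNReal BoundedContinuousFunction unitInterval

namespace Summit.CriticalPhenomena.SAWScalingLimit.Theorems.SimpleSubseqLimits.MarkedPointRevisit.Marked

/-- **Shadowing configuration** of a curve `γ` against an injective curve `η`: at time `s` the curve
`γ` sits at the arc point `η y₁` for the FIRST time; up to the later time `t` it never passes beyond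
level `y₁` of the arc; and every level `y ∈ [y₀, y₁)` (a non-degenerate sub-arc) is visited both
before `s` and again in `(s, t]` — the sub-arc `η [y₀, y₁)` is *shadowed* (idea card
`marked-point-revisit`, lemma `Shadowing`). Verbatim the vocabulary of the registered skeleton
`Cruxes/SimpleSubseqLimits/Lines/marked-point-revisit.lean` (line marked-point-revisit of crux
stmt-CriticalPhenomena-4982). [folklore] -/
def ShadowConfig (η γ : Curve ℂ) (s t y₀ y₁ : I) : Prop :=
  s < t ∧ y₀ < y₁ ∧ γ s = η y₁ ∧ (∀ r : I, r < s → γ r ≠ η y₁) ∧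
    (∀ r : I, r ≤ t → ∃ y : I, y ≤ y₁ ∧ γ r = η y) ∧
    ∀ y : I, y₀ ≤ y → y < y₁ →
      (∃ r : I, r < s ∧ γ r = η y) ∧ (∃ r' : I, s < r' ∧ r' ≤ t ∧ γ r' = η y)

/-- **Marked first-hit configuration** of a curve `γ` at centre `z` and radii `ρ < R`: `T` is the
FIRST hitting time of `closedBall z ρ`, and `lam < T` is an entrance time into `closedBall z R`
after which `γ` stays in that closed ball up to `T`. The MARKED POINT is `γ lam ∈ sphere z R`: a
function of the past `γ|[0,T]` only, at distance `≥ R - ρ` from the tip `γ T`. Verbatim the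
vocabulary of the registered skeleton `Cruxes/SimpleSubseqLimits/Lines/marked-point-revisit.lean` (line
marked-point-revisit of crux stmt-CriticalPhenomena-4982). [folklore] -/
def MarkedConfig (γ : Curve ℂ) (z : ℂ) (ρ R : ℝ) (lam T : I) : Prop :=
  lam < T ∧ γ lam ∈ sphere z R ∧ (∀ u : I, lam ≤ u → u ≤ T → γ u ∈ closedBall z R) ∧
    γ T ∈ closedBall z ρ ∧ ∀ u : I, u < T → γ u ∉ closedBall z ρ

/-- **Separation of the new arc level from the initial sub-arc.** For an injective curve `η` and
levels `y₀ < y₁`, the point `η y₁` is at positive distance from the compact initial sub-arc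
`η '' [0, y₀]`, which does not contain it. [folklore] -/
theorem infDist_initialArc_pos {η : Curve ℂ} (hη : η.IsSimple) {y₀ y₁ : I} (hy : y₀ < y₁) :
    0 < infDist (η y₁) (η '' Set.Icc 0 y₀) := by
  have hK : IsClosed (η '' Set.Icc 0 y₀) := (isCompact_Icc.image η.continuous).isClosed
  refine (hK.notMem_iff_infDist_pos ⟨η 0, 0, ⟨le_rfl, bot_le⟩, rfl⟩).1 ?_
  rintro ⟨y, ⟨-, hy0⟩, hyy⟩
  obtain rfl : y = y₁ := hη hyy
  exact absurd hy0 (not_le.2 hy)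

/-- **Marked first hit forced by a far start.** If `γ` starts strictly more than `R`-far from `z`
and is inside `closedBall z ρ` at some time `s`, with `ρ < R`, then there is a marked first-hit
configuration `(lam, T)` of `γ` at `(z, ρ, R)` with `T ≤ s`: `T :=` the first entrance time into
`closedBall z ρ`, `lam :=` the last time before `T` at distance `≥ R` from `z`; the equality
`dist (γ lam) z = R` is the intermediate value theorem on `[lam, T]`. [folklore] -/
theorem exists_markedConfig {γ : Curve ℂ} {z : ℂ} {ρ R : ℝ} (hρR : ρ < R)
    (h0 : R < dist (γ 0) z) {s : I} (hs : γ s ∈ closedBall z ρ) :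
    ∃ lam T : I, MarkedConfig γ z ρ R lam T ∧ T ≤ s := by
  -- `T :=` the first hitting time of `closedBall z ρ`
  have hS₁ : IsCompact {u : I | γ u ∈ closedBall z ρ} :=
    (isClosed_closedBall.preimage γ.continuous).isCompact
  obtain ⟨T, hT, hTl⟩ := hS₁.exists_isLeast ⟨s, hs⟩
  have hT : γ T ∈ closedBall z ρ := hT
  have hTs : T ≤ s := hTl hs
  have hbefore : ∀ u : I, u < T → γ u ∉ closedBall z ρ := fun u hu huB =>
    absurd (hTl huB) (not_le.2 hu)
  -- `lam :=` the last time `≤ T` at distance `≥ R` from `z`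
  have hf : Continuous fun u : I => dist (γ u) z := γ.continuous.dist continuous_const
  have hS₂ : IsCompact {u : I | u ≤ T ∧ R ≤ dist (γ u) z} :=
    ((isClosed_le continuous_id continuous_const).inter
      (isClosed_le continuous_const hf)).isCompact
  obtain ⟨lam, ⟨hlamT, hlamR⟩, hlamg⟩ := hS₂.exists_isGreatest ⟨0, bot_le, h0.le⟩
  have hTR : dist (γ T) z < R := (mem_closedBall.1 hT).trans_lt hρR
  have hlt : lam < T := by
    refine lt_of_le_of_ne hlamT ?_
    rintro rfl
    exact absurd hlamR (not_le.2 hTR)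
  have hinside : ∀ u : I, lam < u → u ≤ T → dist (γ u) z < R := fun u hlu huT =>
    not_le.1 fun hR => absurd (hlamg ⟨huT, hR⟩) (not_le.2 hlu)
  -- `dist (γ lam) z = R` by the intermediate value theorem on `[lam, T]`
  have heq : dist (γ lam) z = R := by
    obtain ⟨u, ⟨hlu, huT⟩, hu⟩ :=
      intermediate_value_Icc' hlt.le hf.continuousOn ⟨hTR.le, hlamR⟩
    have hul : u ≤ lam := hlamg ⟨huT, hu.ge⟩
    obtain rfl : u = lam := le_antisymm hul hlu
    exact hu
  refine ⟨lam, T, ⟨hlt, mem_sphere.2 heq, fun u hlu huT => ?_, hT, hbefore⟩, hTs⟩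
  rcases hlu.eq_or_lt with rfl | hlu'
  · exact mem_closedBall.2 heq.le
  · exact mem_closedBall.2 (hinside u hlu' huT).le

/-- **Stub 2 of the line `marked-point-revisit` — MARKED FIRST HIT WITH EXACT REVISIT.** A shadowing
configuration of `γ` against the injective curve `η` (same range, same starting point) forces, for
every parameter `(z, ρ, R)` in the open nonempty set
`{ρ < R, dist z (η y₁) < ρ, R + dist z (η y₁) < infDist (η y₁) (η '' [0, y₀])}`, a marked
first-hit configuration `(lam, T)` at `(z, ρ, R)` and a later time `t' > T` with `γ t' = γ lam`:
the marked point `γ lam` lies on the shadowed sub-arc `η [y₀, y₁)`, which `γ` revisits in `(s, t]`.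
[folklore] -/
theorem stub_markedOfShadowing :
    ∀ (η γ : Curve ℂ), η.IsSimple → Set.range γ = Set.range η → γ 0 = η 0 →
      ∀ s t y₀ y₁ : I, ShadowConfig η γ s t y₀ y₁ →
        ∃ U : Set (ℂ × ℝ × ℝ), IsOpen U ∧ U.Nonempty ∧
          ∀ p ∈ U, ∃ lam T t' : I,
            MarkedConfig γ p.1 p.2.1 p.2.2 lam T ∧ T < t' ∧ γ t' = γ lam := by
  intro η γ hη _hr h0 s t y₀ y₁ hS
  obtain ⟨hst, hy, hs1, hfirst, hbelow, hband⟩ := hS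
  -- the separation `d > 0` of the new level `η y₁` from the initial sub-arc `η '' [0, y₀]`
  obtain ⟨d, hdpos, hdle⟩ : ∃ d : ℝ, 0 < d ∧ ∀ y : I, y ≤ y₀ → d ≤ dist (η y₁) (η y) :=
    ⟨_, infDist_initialArc_pos hη hy, fun y hy0 => infDist_le_dist_of_mem ⟨y, ⟨bot_le, hy0⟩, rfl⟩⟩
  refine ⟨{p : ℂ × ℝ × ℝ | p.2.1 < p.2.2 ∧ dist p.1 (η y₁) < p.2.1 ∧ p.2.2 + dist p.1 (η y₁) < d},
    ?_, ?_, ?_⟩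
  · -- `U` is open: three strict inequalities between continuous functions of `p`
    exact (isOpen_lt continuous_snd.fst continuous_snd.snd).and
      ((isOpen_lt (continuous_fst.dist continuous_const) continuous_snd.fst).and
        (isOpen_lt (continuous_snd.snd.add (continuous_fst.dist continuous_const))
          continuous_const))
  · -- `U` is nonempty: `(η y₁, d/4, d/2) ∈ U`
    refine ⟨(η y₁, d / 4, d / 2), ?_, ?_, ?_⟩
    · show d / 4 < d / 2
      linarith
    · show dist (η y₁) (η y₁) < d / 4
      rw [dist_self]
      linarith
    · show d / 2 + dist (η y₁) (η y₁) < d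
      rw [dist_self]
      linarith
  · -- the marked first-hit configuration and the exact revisit, for `p = (z, ρ, R) ∈ U`
    rintro ⟨z, ρ, R⟩ hp
    obtain ⟨hρR, hzρ, hRd⟩ : ρ < R ∧ dist z (η y₁) < ρ ∧ R + dist z (η y₁) < d := hp
    -- `γ 0 = η 0` is more than `R`-far from `z`
    have h0far : R < dist (γ 0) z := by
      have h1 : d ≤ dist (η y₁) (γ 0) := by
        rw [h0]
        exact hdle 0 bot_le
      have h2 := dist_triangle (η y₁) z (γ 0)
      rw [dist_comm (η y₁) z, dist_comm z (γ 0)] at h2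
      linarith
    -- `γ s = η y₁ ∈ closedBall z ρ`
    have hsB : γ s ∈ closedBall z ρ := by
      rw [hs1, mem_closedBall, dist_comm]
      exact hzρ.le
    obtain ⟨lam, T, hM, hTs⟩ := exists_markedConfig hρR h0far hsB
    have hlt : lam < T := hM.1
    have hR : dist (γ lam) z = R := mem_sphere.1 hM.2.1
    -- the marked point lies on the arc at a level `y ∈ [y₀, y₁)`
    have hlams : lam < s := hlt.trans_le hTs
    obtain ⟨y, hy1, hly⟩ := hbelow lam (hlams.trans hst).le
    have hy1' : y < y₁ := by
      refine lt_of_le_of_ne hy1 ?_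
      rintro rfl
      exact hfirst lam hlams hly
    have hy0 : y₀ ≤ y := by
      by_contra hlt0
      have h1 : d ≤ dist (η y₁) (γ lam) := by
        rw [hly]
        exact hdle y (not_le.1 hlt0).le
      have h2 := dist_triangle (η y₁) z (γ lam)
      rw [dist_comm (η y₁) z, dist_comm z (γ lam), hR] at h2
      linarith
    -- the level `y` is revisited in `(s, t]`, after `T ≤ s`
    obtain ⟨-, r', hsr', -, hr'y⟩ := hband y hy0 hy1'
    exact ⟨lam, T, r', hM, hTs.trans_lt hsr', by rw [hr'y, hly]⟩

end Summit.CriticalPhenomena.SAWScalingLimit.Theorems.SimpleSubseqLimits.MarkedPointRevisit.Marked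

end
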